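import Literature.RingTheory.Flat.ShortExact
import HarnessLib

/-!
# A bounded above exact complex of flat modules stays exact after tensoring (Görtz–Wedhorn II, Lemma 21.93 with Lemma 21.96 (2))

Let `R` be a commutative ring and `⋯ → Eⁿ —dⁿ→ Eⁿ⁺¹ → ⋯` a complex of flat `R`-modules which is
**exact** and **bounded above** (`Eⁿ = 0` for `n ≥ N`). Then `E ⊗ M` is exact for every
`R`-module `M`. In the language of Görtz–Wedhorn II, (21.19): a bounded above complex of flat
modules is K-flat (Lemma 21.93, p. 274), and an exact K-flat complex stays exact after tensoring
with anything (Lemma 21.96 (2), p. 276); equivalently Mumford, *Abelian Varieties*, §5, Lemma 2,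
or the Stacks Project, Tag 064K. This is the homological-algebra input for the base change of the
Grothendieck complex `Rf_*𝓕 ⊗^L κ(s)` (Görtz–Wedhorn II, (23.28.5); this tree:
`Literature/AlgebraicGeometry/Motives/GrothendieckComplexH0Projective`).

PROVED here, by the classical direct argument rather than the printed one (truncation triangles
in `K(R)`): with `Zⁿ = Ker dⁿ`,

* `flat_ker_of_exact_of_flat_of_bounded` — all cocycle modules `Zⁿ` are flat: `Zⁿ = 0` for
  `n ≥ N`, and `0 → Zⁿ → Eⁿ → Zⁿ⁺¹ → 0` is exact (exactness of `E`), so flatness descends from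
  `Zⁿ⁺¹` to `Zⁿ` by the Stacks Project, Tag 00HM (2)
  (`Literature.RingTheory.Flat.flat_of_exact_of_flat_of_flat`);
* `exact_lTensor_of_exact_of_flat_of_bounded` — the theorem: `dⁿ⁺¹ ⊗ M` factors as
  `Eⁿ⁺¹ ⊗ M ↠ Zⁿ⁺² ⊗ M ↪ Eⁿ⁺² ⊗ M`, the second map injective by Tag 00HL
  (`Literature.RingTheory.Flat.lTensor_injective_of_exact_of_flat`, as `Zⁿ⁺³` is flat), so
  `Ker(dⁿ⁺¹ ⊗ M) = Ker(Eⁿ⁺¹ ⊗ M → Zⁿ⁺² ⊗ M) = Im(Zⁿ⁺¹ ⊗ M → Eⁿ⁺¹ ⊗ M) = Im(dⁿ ⊗ M)` by right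
  exactness of `− ⊗ M`.

The complex is unbundled (`E : ℤ → Type`, `d n : E n →ₗ[R] E (n + 1)`, exactness as
`Function.Exact (d n) (d (n + 1))`), which is the form in which both Mathlib's `lTensor_exact` and
the concrete Čech complexes of this tree speak; boundedness is `Subsingleton (E n)` for `n ≥ N`.
Mathlib searched (pin): `Module.Flat`, `lTensor_exact`, `LinearMap.lTensor_comp`,
`LinearMap.ker_comp_of_ker_eq_bot`, `LinearMap.range_comp_of_range_eq_top`,
`LinearMap.ker_codRestrict`, `LinearMap.codRestrict`, `Module.Free.of_subsingleton` (used); Mathlib has K-projective and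
K-injective complexes (`Algebra/Homology/HomotopyCategory/KProjective`) but no K-flatness and no
statement about tensoring exact complexes of flat modules.

## References

* U. Görtz, T. Wedhorn, *Algebraic Geometry II: Cohomology of Schemes*, Springer Spektrum (2023),
  doi:10.1007/978-3-658-43031-3: Def. 21.91, Rem. 21.92, Lemma 21.93, pp. 273–274; Lemma 21.96,
  p. 276 (read via the held copy). [GortzWedhorn2023]
* The Stacks Project, Tag 064K (More on Algebra, Lemma 15.59.7/15.60.7: "Let `P•` be a bounded
  above complex of flat `R`-modules. Then `P•` is K-flat."), Tags 00HL, 00HM. [StacksProject]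
* D. Mumford, *Abelian Varieties*, TIFR Studies in Mathematics 5 (1970), §5, Lemma 2. [MumfordAV1970]
-/

universe u v w

namespace Literature.Algebra.Homology

open Literature.RingTheory.Flat

variable {R : Type u} [CommRing R] {E : ℤ → Type v} [∀ n, AddCommGroup (E n)]
  [∀ n, Module R (E n)] {d : ∀ n, E n →ₗ[R] E (n + 1)}

/-! Below, the corestriction `Eⁿ → Zⁿ⁺¹ = Ker dⁿ⁺¹` of `dⁿ` (`dⁿ⁺¹ dⁿ = 0`) is written
`(d n).codRestrict (LinearMap.ker (d (n + 1))) _` (Mathlib `LinearMap.codRestrict`). -/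

/-- `Zⁿ ↪ Eⁿ → Zⁿ⁺¹` is exact in the middle: the kernel of `Eⁿ → Zⁿ⁺¹` is `Zⁿ = Ker dⁿ`.
[folklore] -/
theorem exact_subtype_codRestrict_ker (hdd : ∀ n (x : E n), d (n + 1) (d n x) = 0) (n : ℤ) :
    Function.Exact (LinearMap.ker (d n)).subtype
      ((d n).codRestrict (LinearMap.ker (d (n + 1))) fun x => LinearMap.mem_ker.2 (hdd n x)) := by
  rw [LinearMap.exact_iff, LinearMap.ker_codRestrict, Submodule.range_subtype]

/-- For an exact complex, `Eⁿ → Zⁿ⁺¹` is surjective (`Im dⁿ = Ker dⁿ⁺¹`). [folklore] -/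
theorem codRestrict_ker_surjective (hex : ∀ n, Function.Exact (d n) (d (n + 1))) (n : ℤ) :
    Function.Surjective ((d n).codRestrict (LinearMap.ker (d (n + 1)))
      fun x => LinearMap.mem_ker.2 ((hex n).apply_apply_eq_zero x)) := by
  intro z
  obtain ⟨x, hx⟩ := ((hex n) (z : E (n + 1))).1 z.2
  exact ⟨x, Subtype.ext hx⟩

/-- **The cocycles of a bounded above exact complex of flat modules are flat**: if every `Eⁿ` is
flat, `E` is exact and `Eⁿ = 0` for `n ≥ N`, then every `Zⁿ = Ker dⁿ` is flat — by descending
induction along the exact sequences `0 → Zⁿ → Eⁿ → Zⁿ⁺¹ → 0` (Stacks Project, Tag 00HM (2)),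
starting from `Zⁿ = 0` for `n ≥ N` (Görtz–Wedhorn II, proof of Lemma 21.93, induction on the
length). [cite: GortzWedhorn2023, Lemma 21.93 (p. 274)] -/
theorem flat_ker_of_exact_of_flat_of_bounded (hflat : ∀ n, Module.Flat R (E n))
    (hex : ∀ n, Function.Exact (d n) (d (n + 1))) {N : ℤ} (hN : ∀ n, N ≤ n → Subsingleton (E n))
    (n : ℤ) : Module.Flat R (LinearMap.ker (d n)) := by
  have hdd : ∀ n (x : E n), d (n + 1) (d n x) = 0 := fun n x => (hex n).apply_apply_eq_zero x
  -- one step down: `Zⁿ⁺¹` flat ⇒ `Zⁿ` flat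
  have step : ∀ m : ℤ, Module.Flat R (LinearMap.ker (d (m + 1))) →
      Module.Flat R (LinearMap.ker (d m)) := fun m hm => by
    haveI := hm
    haveI := hflat m
    exact flat_of_exact_of_flat_of_flat (exact_subtype_codRestrict_ker hdd m)
      (LinearMap.ker (d m)).injective_subtype (codRestrict_ker_surjective hex m)
  -- descending induction from `n + k ≥ N`
  have key : ∀ (k : ℕ) (m : ℤ), N ≤ m + k → Module.Flat R (LinearMap.ker (d m)) := by
    intro k
    induction k with
    | zero =>
      intro m hm
      haveI : Subsingleton (E m) := hN m (by simpa using hm)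
      infer_instance
    | succ k ih =>
      intro m hm
      exact step m (ih (m + 1) (by push_cast at hm ⊢; omega))
  exact key (N - n).toNat n (by omega)

/-- **A bounded above exact complex of flat modules stays exact after tensoring with any module**
(Görtz–Wedhorn II, Lemma 21.93: "Let `𝓟` be a bounded above complex of flat `𝒪_X`-modules. Then
`𝓟` is a K-flat complex." with Lemma 21.96 (2): "For every exact K-flat complex `𝓟` the complex
`𝓟 ⊗ 𝓕` is exact for all complexes `𝓕`", here for `𝓕 = M` a module; Mumford, *Abelian
Varieties*, §5, Lemma 2; Stacks Project, Tag 064K): if every `Eⁿ` is flat, `E` is exact and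
`Eⁿ = 0` for `n ≥ N`, then `⋯ → M ⊗ Eⁿ —M ⊗ dⁿ→ M ⊗ Eⁿ⁺¹ → ⋯` is exact for every `R`-module `M`.
[cite: GortzWedhorn2023, Lemma 21.93 and Lemma 21.96 (2) (pp. 274, 276)] -/
theorem exact_lTensor_of_exact_of_flat_of_bounded (hflat : ∀ n, Module.Flat R (E n))
    (hex : ∀ n, Function.Exact (d n) (d (n + 1))) {N : ℤ} (hN : ∀ n, N ≤ n → Subsingleton (E n))
    (M : Type w) [AddCommGroup M] [Module R M] (n : ℤ) :
    Function.Exact ((d n).lTensor M) ((d (n + 1)).lTensor M) := by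
  have hdd : ∀ n (x : E n), d (n + 1) (d n x) = 0 := fun n x => (hex n).apply_apply_eq_zero x
  have hZ : ∀ m, Module.Flat R (LinearMap.ker (d m)) :=
    flat_ker_of_exact_of_flat_of_bounded hflat hex hN
  -- notation: `ι m : Z m ↪ E m`, `q m : E m ↠ Z (m+1)`
  set q : ∀ m : ℤ, E m →ₗ[R] LinearMap.ker (d (m + 1)) := fun m =>
    (d m).codRestrict (LinearMap.ker (d (m + 1))) fun x => LinearMap.mem_ker.2 (hdd m x) with hq
  have hιq : ∀ m, Function.Exact (LinearMap.ker (d m)).subtype (q m) :=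
    exact_subtype_codRestrict_ker hdd
  have hq_surj : ∀ m, Function.Surjective (q m) := codRestrict_ker_surjective hex
  have hd : ∀ m, d m = (LinearMap.ker (d (m + 1))).subtype ∘ₗ q m :=
    fun m => (LinearMap.subtype_comp_codRestrict _ _ _).symm
  -- `Z m ⊗ M → E m ⊗ M` is injective (Tag 00HL, `Z (m+1)` flat)
  have hι_inj : ∀ m, Function.Injective ((LinearMap.ker (d m)).subtype.lTensor M) := fun m => by
    haveI := hZ (m + 1)
    exact lTensor_injective_of_exact_of_flat (hιq m) (LinearMap.ker (d m)).injective_subtype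
      (hq_surj m) M
  rw [LinearMap.exact_iff]
  -- `Ker(d (n+1) ⊗ M) = Ker(q (n+1) ⊗ M)`
  have h1 : LinearMap.ker ((d (n + 1)).lTensor M) = LinearMap.ker ((q (n + 1)).lTensor M) := by
    rw [hd (n + 1), LinearMap.lTensor_comp]
    exact LinearMap.ker_comp_of_ker_eq_bot _ (LinearMap.ker_eq_bot.2 (hι_inj (n + 1 + 1)))
  -- `Ker(q (n+1) ⊗ M) = Im(ι (n+1) ⊗ M)` (right exactness)
  have h2 : LinearMap.ker ((q (n + 1)).lTensor M) =
      LinearMap.range ((LinearMap.ker (d (n + 1))).subtype.lTensor M) :=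
    (LinearMap.exact_iff).1 (lTensor_exact M (hιq (n + 1)) (hq_surj (n + 1)))
  -- `Im(d n ⊗ M) = Im(ι (n+1) ⊗ M)` (`q n ⊗ M` is surjective)
  have h3 : LinearMap.range ((d n).lTensor M) =
      LinearMap.range ((LinearMap.ker (d (n + 1))).subtype.lTensor M) := by
    rw [hd n, LinearMap.lTensor_comp]
    exact LinearMap.range_comp_of_range_eq_top _
      (LinearMap.range_eq_top.2 (LinearMap.lTensor_surjective M (hq_surj n)))
  rw [h1, h2, h3]

/-- Right-handed form of `exact_lTensor_of_exact_of_flat_of_bounded`: `E ⊗ M` is exact.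
[cite: GortzWedhorn2023, Lemma 21.93 and Lemma 21.96 (2) (pp. 274, 276)] -/
theorem exact_rTensor_of_exact_of_flat_of_bounded (hflat : ∀ n, Module.Flat R (E n))
    (hex : ∀ n, Function.Exact (d n) (d (n + 1))) {N : ℤ} (hN : ∀ n, N ≤ n → Subsingleton (E n))
    (M : Type w) [AddCommGroup M] [Module R M] (n : ℤ) :
    Function.Exact ((d n).rTensor M) ((d (n + 1)).rTensor M) := by
  rw [LinearMap.rTensor_exact_iff_lTensor_exact]
  exact exact_lTensor_of_exact_of_flat_of_bounded hflat hex hN M n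

end Literature.Algebra.Homology
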